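import Summits.Ventures.CertifiedManyBodySolver.Theorems.CovHg1201M19P10KinematicPartsTp
import Summits.Ventures.CertifiedManyBodySolver.Rows.DopedTLCorrBundleWN
import Summits.Ventures.CertifiedManyBodySolver.Certificates.HubbardSquare_hg1201M19_stripCaps
import HarnessLib

/-!
# Ventures/CertifiedManyBodySolver — Theorems/CovHg1201M19P10BundleWNClosers.lean (@10 twin of `Theorems/CovHg1201M19BundleWNClosers.lean`)

HONEST FRAMING: zero-solve CLOSERS (pure bookkeeping) for crux «PatchLeftEdgeP10» (stmt-Ventures-27104) of route `CovHg1201M19P10` — the @10 GPa COLUMN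
(box `boxHg1201E_M19P10`, corner `(U, t′, n) = (3, −49/100, 22/25)`, bar″ `0.4767609 = 0.98 × 0.4864907`) of the HgBa₂CuO₄₊δ «Hg-1201» coverage programme
(D-0154 (1)(C)); the `P = 10 GPa` twin of hubbard-cov-hg1201-box-1 g1's `Theorems/CovHg1201M19BundleWNClosers.lean` (M19) / `CovHg1201M19bBundleWNClosers.lean` (M19b).
After this seat's kinematic cuts (`Theorems/CovHg1201M19P10KinematicParts{,Tp}.lean`: densities `n ≤ 43/50` and slots `σ ∈ [−12/25, −47/100]` are state-free) the
certificate part of «PatchLeftEdgeP10» is the LEFT-EDGE FAMILY on the thick strip: for every `n ∈ [43/50, 22/25]`, `σ ∈ [−49/100, −47/100]` (the chord to the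
kinematic `−47/100` END covers the whole slot range), `U′ ∈ [3, 17/2]` and every torus-limit sector GS at `(−49/100, U′, n)`: `−0.4767609 ≤ |D₄|⁻¹ Σ_γ Re ω_γ(−X₀(σ, U′))`.
This file turns PINNED-PAIR `U`-segment reads of the @10 left edge (hub «A″3» kit j305288 at `U = 3`, `Certificates/HubbardSquare_Hg1201_AP10U3_…_j305288.lean`;
the `U`-spokes authorised on hubbard-cov-hg1201-sdp-1's lane, captain hubbard-cov-hg1201-plan-1 2026-08-28T15:52:53Z), typed in the bundle-WN shape
`SquareTTPrimeBundleOrbitLowerRowWN U₁ U₂ (−49/100) (−49/100) flo cap F sl₁ sl₂ (22/25) …` (density extent by the families' own filling multipliers), into the item: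
§1 window functions on the thick left cell `![U₁, −49/100, 43/50] … ![U₂, −49/100, 22/25]` (kinematic floor; TOP-PLANE cap = the `22/25` kernel HF row
`hfCap_hg1201P10_m490_n088_point`, valid for `U₁ ≥ 3`; CONSTANT cap from the two fully polarised rows `hgM19_polCap_n8600` / `hgP19_polCap_n8800` read at `−49/100`;
AFFINE-in-`U` cap above the top plane at the two cell ends), §2 the left-edge family on a `U`-segment from ONE thick windowed box row with GENERAL windows,
§3 thick row and per-cell closers from ONE bundle-WN node (three rational prices `−F`, `−F − sl_j·(43/50 − 22/25) ≤ 0.4767609`) and the two WND CONSUMERS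
(`…_of_thickBoxRowW_affineCap / _constCap`: the docc-ext node files' own thick-row adapters feed them), §4 glue (union / chain) and the
item closers `covHg1201M19P10_PatchLeftEdgeP10_of_leftEdgeStrip / _of_twoCells / _of_chain`. No def. Nothing here is a certificate or a number of
record; CONTROL / CALIBRATION class words only flow through it (xx1; «content» = below 0.98 × the @10 kinematic MAJORANT, no suppression below free claimed);
a ceiling never speaks to the presence of superconductivity; not a `T_c` / phase / pressure sentence; nothing about HgBa₂CuO₄₊δ; no item is closed by this
file alone. Seat `hubbard-cov-hg1201-box-2` g1 (`prover-hubbard-cov-hg1201-box-2-g0-0`).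

References: S. Boyd, L. Vandenberghe, *Convex Optimization* (2004) §5.9 [BoydVandenberghe2004]; T. Koma, H. Tasaki, J. Stat. Phys. 76 (1994) 745, §1 [KomaTasaki1994];
D. J. Scalapino, S. R. White, S.-C. Zhang, PRB 47 (1993) 7995, §II [ScalapinoWhiteZhang1993]; J. Wang et al., PRX 14 (2024) 031006, §III [WangEtAl2024];
V. Bach, E. H. Lieb, J. P. Solovej, J. Stat. Phys. 76 (1994) 3, eq. (2c.36) [BachLiebSolovej1994]; R. B. Israel, *Convexity in the Theory of Lattice Gases* (1979), Thm. I.3.4 [Israel1979].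
-/

noncomputable section

namespace Summit.Ventures.CertifiedManyBodySolver.Theorems

open Real Set Filter Topology
open Summit.Ventures.CertifiedManyBodySolver Summit.Ventures.CertifiedManyBodySolver.Observables Summit.Ventures.CertifiedManyBodySolver.Downfold Summit.Ventures.CertifiedManyBodySolver.Certificates
open Summit.Ventures.CertifiedManyBodySolver.Theses.CovHg1201M19P10 (PatchLeftEdgeP10)
open Literature.MathematicalPhysics.QuantumLattice Literature.MathematicalPhysics.QuantumLattice.ThermodynamicLimit Literature.Probability.LatticeModels
open Matrix HubbardWave0
open scoped BigOperators ComplexOrder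

/-! ## §0 Local helpers -/

/-- Coordinates of a point of a literal `Fin 3` cell (router order `(U, t′, n)`); local copy. [folklore] -/
private theorem p10l_mem_vec3 {a b c a' b' c' : ℝ} {θ : Fin 3 → ℝ}
    (hθ : θ ∈ Set.Icc (![a, b, c] : Fin 3 → ℝ) ![a', b', c']) :
    (a ≤ θ 0 ∧ θ 0 ≤ a') ∧ (b ≤ θ 1 ∧ θ 1 ≤ b') ∧ (c ≤ θ 2 ∧ θ 2 ≤ c') := by
  rw [Set.mem_Icc, Pi.le_def, Pi.le_def] at hθ
  obtain ⟨hlo, hhi⟩ := hθ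
  have h0 := hlo 0; have h1 := hlo 1; have h2 := hlo 2
  have h0' := hhi 0; have h1' := hhi 1; have h2' := hhi 2
  simp only [Matrix.cons_val_zero, Matrix.cons_val_one, Matrix.head_cons, Matrix.cons_val_two,
    Matrix.tail_cons] at h0 h1 h2 h0' h1' h2'
  exact ⟨⟨h0, h0'⟩, ⟨h1, h1'⟩, ⟨h2, h2'⟩⟩

/-- The STRIP SLOT of a bundle-WN read solved at `22/25`, `min F (min (F + sl₁·(43/50 − 22/25)) (F + sl₂·(43/50 − 22/25)))`, is below the four end values
(local copy of box-1's `m19_bundleWNStripSlot_le`). [folklore] -/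
private theorem p10l_bundleWNStripSlot_le (F sl₁ sl₂ : ℚ) :
    (min F (min (F + sl₁ * (43 / 50 - 22 / 25)) (F + sl₂ * (43 / 50 - 22 / 25)))) ≤ F + sl₁ * (43 / 50 - 22 / 25) ∧
    (min F (min (F + sl₁ * (43 / 50 - 22 / 25)) (F + sl₂ * (43 / 50 - 22 / 25)))) ≤ F + sl₁ * (22 / 25 - 22 / 25) ∧
    (min F (min (F + sl₁ * (43 / 50 - 22 / 25)) (F + sl₂ * (43 / 50 - 22 / 25)))) ≤ F + sl₂ * (43 / 50 - 22 / 25) ∧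
    (min F (min (F + sl₁ * (43 / 50 - 22 / 25)) (F + sl₂ * (43 / 50 - 22 / 25)))) ≤ F + sl₂ * (22 / 25 - 22 / 25) := by
  refine ⟨?_, ?_, ?_, ?_⟩
  · exact (min_le_right _ _).trans (min_le_left _ _)
  · simp only [sub_self, mul_zero, add_zero]; exact min_le_left _ _
  · exact (min_le_right _ _).trans (min_le_right _ _)
  · simp only [sub_self, mul_zero, add_zero]; exact min_le_left _ _

/-- The PRICE of the strip slot from the three end prices (local copy of box-1's `m19_neg_bundleWNStripSlot_le`). [folklore] -/
private theorem p10l_neg_bundleWNStripSlot_le {F sl₁ sl₂ c : ℚ} (p₀ : -F ≤ c) (p₁ : -F - sl₁ * (43 / 50 - 22 / 25) ≤ c)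
    (p₂ : -F - sl₂ * (43 / 50 - 22 / 25) ≤ c) :
    -(((min F (min (F + sl₁ * (43 / 50 - 22 / 25)) (F + sl₂ * (43 / 50 - 22 / 25)))) : ℚ) : ℝ) ≤ ((c : ℚ) : ℝ) := by
  have h : -((min F (min (F + sl₁ * (43 / 50 - 22 / 25)) (F + sl₂ * (43 / 50 - 22 / 25))))) ≤ c := by
    rcases min_choice F (min (F + sl₁ * (43 / 50 - 22 / 25)) (F + sl₂ * (43 / 50 - 22 / 25))) with h | h <;> rw [h]
    · linarith
    · rcases min_choice (F + sl₁ * (43 / 50 - 22 / 25)) (F + sl₂ * (43 / 50 - 22 / 25)) with h' | h' <;> rw [h'] <;> linarith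
  exact_mod_cast h

/-! ## §1 Window functions on the thick @10 left cell `![U₁, −49/100, 43/50] … ![U₂, −49/100, 22/25]` (functions of `(U, t′)` as the bundle-WN shape wants) -/

/-- **KINEMATIC FLOOR** on the thick left cell (a-priori constant `−124827703/5·10⁷`, any `U₁ ≥ 0`). [cite: LiebLoss1993, §8, Theorem 8.2] -/
theorem covHg1201M19P10_leftThickCell_kinFloorFn {U₁ U₂ : ℝ} (hU₁ : 0 ≤ U₁) :
    ∀ θ ∈ Set.Icc (![U₁, -49 / 100, 43 / 50] : Fin 3 → ℝ) ![U₂, -49 / 100, 22 / 25],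
      (fun (_ _ : ℝ) => (((-124827703/50000000 : ℚ)) : ℝ)) (θ 0) (θ 1) ≤ energyDensityTT' 1 (θ 1) (θ 0) (θ 2) :=
  fun θ hθ => covHg1201P10_cell_kinFloor hU₁ (by norm_num) (by norm_num) (by norm_num) (by norm_num) θ hθ

/-- **TOP PLANE CAP** (the @10 `22/25` kernel HF row `hfCap_hg1201P10_m490_n088_point`, `−15830689/10⁷ + U·121/625`): caps the whole thick cell whenever `U₁ ≥ 3` — the
density chord of the `43/50` and `22/25` kernel rows lies below the `22/25` (top) row there (the rows cross at `U = 129821/43500 ≈ 2.98439 < 3`).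
[cite: BachLiebSolovej1994, eq. (2c.36)] [cite: Israel1979, Thm. I.3.4] -/
theorem covHg1201M19P10_leftThickCell_topPlaneCap {U₁ U₂ : ℝ} (hU₁ : 3 ≤ U₁) :
    ∀ θ ∈ Set.Icc (![U₁, -49 / 100, 43 / 50] : Fin 3 → ℝ) ![U₂, -49 / 100, 22 / 25],
      energyDensityTT' 1 (θ 1) (θ 0) (θ 2) ≤
        (fun (U _ : ℝ) => ((-15830689/10000000 : ℚ) : ℝ) + U * ((121/625 : ℚ) : ℝ)) (θ 0) (θ 1) := by
  intro θ hθ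
  beta_reduce
  obtain ⟨⟨h0, -⟩, ⟨h1, h1'⟩, ⟨h2, h2'⟩⟩ := p10l_mem_vec3 hθ
  have e1 : θ 1 = -49 / 100 := le_antisymm h1' h1
  have hU : 0 ≤ θ 0 := le_trans (by norm_num) (hU₁.trans h0)
  rw [e1]
  have c86 := hfCap_hg1201P10_m490_n086_point hU
  have c88 := hfCap_hg1201P10_m490_n088_point hU
  have hch := energyDensityTT'_le_density_chord_of_mem_Icc 1 (-49 / 100) hU (m₁ := 43 / 50) (m₂ := 22 / 25) (by norm_num) (by norm_num) (by norm_num)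
    c86 c88 (n := θ 2) ⟨h2, h2'⟩
  refine hch.trans ?_
  rw [div_le_iff₀ (by norm_num)]
  have hU' : 3 ≤ θ 0 := hU₁.trans h0
  have d1 : (((-15571047/10000000 : ℚ)) : ℝ) + θ 0 * (((1849/10000 : ℚ)) : ℝ) ≤ ((-15830689/10000000 : ℚ) : ℝ) + θ 0 * ((121/625 : ℚ) : ℝ) := by
    push_cast; linarith
  have w1 : 0 ≤ 22 / 25 - θ 2 := by linarith
  have w2 : 0 ≤ θ 2 - 43 / 50 := by linarith
  nlinarith [mul_le_mul_of_nonneg_left d1 w1, w2]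

/-- **AFFINE-in-`U` CAP above the top plane at the two cell ends** (`U₁ ≥ 3`; e.g. a hub cap overridden up to a spoke's value): `ca + U·cb` caps the thick cell as soon as
it is above `−15830689/10⁷ + U·121/625` at `U = U₁` and at `U = U₂`. [cite: Israel1979, Thm. I.3.4] -/
theorem covHg1201M19P10_leftThickCell_affineCap_of_topPlane {U₁ U₂ : ℝ} (hU₁ : 3 ≤ U₁) {ca cb : ℚ}
    (he₁ : ((-15830689/10000000 : ℚ) : ℝ) + U₁ * ((121/625 : ℚ) : ℝ) ≤ ((ca : ℚ) : ℝ) + U₁ * ((cb : ℚ) : ℝ))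
    (he₂ : ((-15830689/10000000 : ℚ) : ℝ) + U₂ * ((121/625 : ℚ) : ℝ) ≤ ((ca : ℚ) : ℝ) + U₂ * ((cb : ℚ) : ℝ)) :
    ∀ θ ∈ Set.Icc (![U₁, -49 / 100, 43 / 50] : Fin 3 → ℝ) ![U₂, -49 / 100, 22 / 25],
      energyDensityTT' 1 (θ 1) (θ 0) (θ 2) ≤ (fun (U _ : ℝ) => ((ca : ℚ) : ℝ) + U * ((cb : ℚ) : ℝ)) (θ 0) (θ 1) := by
  intro θ hθ
  have htop := covHg1201M19P10_leftThickCell_topPlaneCap hU₁ θ hθ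
  beta_reduce at htop ⊢
  obtain ⟨⟨h0, h0'⟩, -, -⟩ := p10l_mem_vec3 hθ
  refine htop.trans ?_
  rcases (h0.trans h0').eq_or_lt with heq | hlt
  · have e0 : θ 0 = U₁ := le_antisymm (heq ▸ h0') h0
    rw [e0]; exact he₁
  · have w1 : 0 ≤ U₂ - θ 0 := by linarith
    have w2 : 0 ≤ θ 0 - U₁ := by linarith
    nlinarith [mul_le_mul_of_nonneg_left he₁ w1, mul_le_mul_of_nonneg_left he₂ w2, hlt]

/-- **CONSTANT CAP from the two fully polarised rows read at `t′ = −49/100`** (`hgM19_polCap_n8600`: `−4445512139/10¹⁰ + (−49/100)·108637/312500 = −6148940299/10¹⁰`;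
`hgP19_polCap_n8800`: `−3946351787/10¹⁰ + (−49/100)·798417/2500000 = −5511249107/10¹⁰`): every constant `c` above both caps the whole thick cell, any `U₁ ≥ 0`
(booking «hub cap overridden up to the spoke's constant» for a high-`U` pair). HYPOTHESIS-FREE. [cite: Israel1979, Thm. I.3.4] -/
theorem covHg1201M19P10_leftThickCell_constCap_of_polCaps {U₁ U₂ : ℝ} (hU₁ : 0 ≤ U₁) {c : ℚ}
    (hc₁ : (-6148940299/10000000000 : ℚ) ≤ c) (hc₂ : (-5511249107/10000000000 : ℚ) ≤ c) :
    ∀ θ ∈ Set.Icc (![U₁, -49 / 100, 43 / 50] : Fin 3 → ℝ) ![U₂, -49 / 100, 22 / 25],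
      energyDensityTT' 1 (θ 1) (θ 0) (θ 2) ≤ (fun (_ _ : ℝ) => ((c : ℚ) : ℝ)) (θ 0) (θ 1) := by
  intro θ hθ
  beta_reduce
  obtain ⟨⟨h0, -⟩, ⟨h1, h1'⟩, ⟨h2, h2'⟩⟩ := p10l_mem_vec3 hθ
  have e1 : θ 1 = -49 / 100 := le_antisymm h1' h1
  have hU : 0 ≤ θ 0 := hU₁.trans h0
  rw [e1]
  have c86 : energyDensityTT' 1 (-49 / 100) (θ 0) (43 / 50) ≤ (((-6148940299/10000000000 : ℚ)) : ℝ) :=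
    (hgM19_polCap_n8600 hU (s := -49 / 100) (by norm_num) (by norm_num)).trans (by norm_num)
  have c88 : energyDensityTT' 1 (-49 / 100) (θ 0) (22 / 25) ≤ (((-5511249107/10000000000 : ℚ)) : ℝ) :=
    (hgP19_polCap_n8800 hU (s := -49 / 100) (by norm_num) (by norm_num)).trans (by norm_num)
  have hch := energyDensityTT'_le_density_chord_of_mem_Icc 1 (-49 / 100) hU (m₁ := 43 / 50) (m₂ := 22 / 25) (by norm_num) (by norm_num) (by norm_num)
    c86 c88 (n := θ 2) ⟨h2, h2'⟩
  refine hch.trans ?_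
  rw [div_le_iff₀ (by norm_num)]
  have hc₁' : (((-6148940299/10000000000 : ℚ)) : ℝ) ≤ ((c : ℚ) : ℝ) := by exact_mod_cast hc₁
  have hc₂' : (((-5511249107/10000000000 : ℚ)) : ℝ) ≤ ((c : ℚ) : ℝ) := by exact_mod_cast hc₂
  have w1 : 0 ≤ 22 / 25 - θ 2 := by linarith
  have w2 : 0 ≤ θ 2 - 43 / 50 := by linarith
  nlinarith [mul_le_mul_of_nonneg_left hc₁' w1, mul_le_mul_of_nonneg_left hc₂' w2]

/-! ## §2 The @10 left-edge family on a `U`-segment from ONE thick windowed box row (GENERAL windows) -/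

/-- **Left-edge family on `[U₁, U₂] × [n₁, n₂]` (`[n₁, n₂] ⊆ [0, 22/25]`) FROM ONE WINDOWED `U`-SEGMENT BOX ROW** on `![U₁, −49/100, n₁] … ![U₂, −49/100, n₂]` (any window
functions `flo`/`cap` discharged by `hflo`/`hcap`; `−r ≤ 0.4767609`; any `U`-label `Uo` of the corner objective: `λ = 0`): the row is read at the class point
`![U′, −49/100, n]` and the target-slot word at every `σ ∈ [−49/100, −47/100]` is the `σ`-chord of that value with the kinematic `−47/100` END reading
(`covHg1201P10_slotWord_of_cornerValue`). [cite: KomaTasaki1994, §1] [cite: ScalapinoWhiteZhang1993, §II] [cite: BoydVandenberghe2004, §5.9] -/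
theorem covHg1201M19P10_leftEdgeSegment_of_boxRowW {U₁ U₂ n₁ n₂ : ℝ} (hn₁ : 0 ≤ n₁) (hn₂ : n₂ ≤ 22 / 25)
    {flo cap : (Fin 3 → ℝ) → ℝ} {r : ℚ} (Uo : ℝ)
    (hrow : SquareTTPrimeCorrOrbitLowerBoxRowW ![U₁, -49 / 100, n₁] ![U₂, -49 / 100, n₂] flo cap r Finset.univ (box 2 7) (-oddMomentObsTT (-49 / 100) Uo 0))
    (hflo : ∀ θ ∈ Set.Icc (![U₁, -49 / 100, n₁] : Fin 3 → ℝ) ![U₂, -49 / 100, n₂], flo θ ≤ energyDensityTT' 1 (θ 1) (θ 0) (θ 2))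
    (hcap : ∀ θ ∈ Set.Icc (![U₁, -49 / 100, n₁] : Fin 3 → ℝ) ![U₂, -49 / 100, n₂], energyDensityTT' 1 (θ 1) (θ 0) (θ 2) ≤ cap θ)
    (hr : -((r : ℚ) : ℝ) ≤ (4767609 / 10000000 : ℝ)) :
    ∀ n ∈ Set.Icc n₁ n₂, ∀ σ ∈ Set.Icc (-49 / 100 : ℝ) (-47 / 100), ∀ U' ∈ Set.Icc U₁ U₂,
      ∀ (ω : InfVolFermionState 2) (Ls : ℕ → ℕ) (ψ : ∀ L, Fock (Orb (FermionTorus 2 L))),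
      Tendsto Ls atTop atTop →
      (∀ j, IsGroundStateInSector (hubbardTorusTT' (Ls j) 1 (-49 / 100) U') (rectN n (Ls j)) 0 (ψ (Ls j))) →
      (∀ j, star (ψ (Ls j)) ⬝ᵥ ψ (Ls j) = 1) → ω.IsTorusLimitOf ψ Ls →
      -(4767609 / 10000000 : ℝ) ≤ ((Finset.univ : Finset (DihedralGroup 4)).card : ℝ)⁻¹ * ∑ g ∈ (Finset.univ : Finset (DihedralGroup 4)),
        (ω.expect (d4ShiftSet g 0 (box 2 7)) (fermionEmbed (PolySite.d4Emb g 0 (box 2 7)) (-oddMomentObsTT σ U' 0))).re := by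
  intro n hn σ hσ U' hU' ω Ls ψ hLs hψ h1 hω
  have hθ : (![U', -49 / 100, n] : Fin 3 → ℝ) ∈ Set.Icc (![U₁, -49 / 100, n₁] : Fin 3 → ℝ) ![U₂, -49 / 100, n₂] :=
    covHg1201P10_vec3_mem_Icc ⟨hU', ⟨le_rfl, le_rfl⟩, hn⟩
  have hf := hflo _ hθ
  have hc := hcap _ hθ
  have hh := hrow _ hθ ω Ls ψ hLs
  simp only [Matrix.cons_val_zero, Matrix.cons_val_one, Matrix.head_cons, Matrix.cons_val_two, Matrix.tail_cons] at hf hc hh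
  have hP : ((r : ℚ) : ℝ) ≤ ((Finset.univ : Finset (DihedralGroup 4)).card : ℝ)⁻¹ * ∑ g ∈ (Finset.univ : Finset (DihedralGroup 4)),
      (ω.expect (d4ShiftSet g 0 (box 2 7)) (fermionEmbed (PolySite.d4Emb g 0 (box 2 7)) (-oddMomentObsTT (-49 / 100) U' 0))).re := by
    rw [oddMomentObsTT_lam_zero (-49 / 100) U', ← oddMomentObsTT_lam_zero (-49 / 100) Uo]
    exact hh hψ h1 hω hf hc
  exact covHg1201P10_slotWord_of_cornerValue σ U' (-49 / 100) U' hσ (hn₁.trans hn.1) (hn.2.trans hn₂) hr ω Ls ψ hLs hψ h1 hω hP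

/-! ## §3 ONE bundle-WN node on `[U₁, U₂] × {−49/100}` read at `22/25` ⇒ the family on the thick `U`-cell -/

/-- **THICK BOX ROW of a @10 left-edge bundle-WN node** (family on `[U₁, U₂] × {−49/100}` read at `22/25`): the windowed row on `![U₁, −49/100, 43/50] … ![U₂, −49/100, 22/25]`
with the strip slot. [cite: BoydVandenberghe2004, §5.9] -/
theorem covHg1201M19P10_leftThickCell_boxRowW_of_bundleWN {U₁ U₂ : ℝ} {flo cap : ℝ → ℝ → ℝ} {F sl₁ sl₂ : ℚ} {X : FermionOp (box 2 7)}
    (hrow : SquareTTPrimeBundleOrbitLowerRowWN U₁ U₂ (-49 / 100) (-49 / 100) flo cap F sl₁ sl₂ (22 / 25) Finset.univ (box 2 7) X) :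
    SquareTTPrimeCorrOrbitLowerBoxRowW ![U₁, -49 / 100, 43 / 50] ![U₂, -49 / 100, 22 / 25] (fun θ => flo (θ 0) (θ 1)) (fun θ => cap (θ 0) (θ 1))
      (min F (min (F + sl₁ * (43 / 50 - 22 / 25)) (F + sl₂ * (43 / 50 - 22 / 25)))) Finset.univ (box 2 7) X := by
  obtain ⟨a, b, c, d⟩ := p10l_bundleWNStripSlot_le F sl₁ sl₂
  have h := hrow.orbitLowerBoxRowW_thick_rat (n₁ := 43 / 50) (n₂ := 22 / 25) (by norm_num) (by norm_num) a b c d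
  have e1 : (((43 / 50 : ℚ)) : ℝ) = 43 / 50 := by norm_num
  have e2 : (((22 / 25 : ℚ)) : ℝ) = 22 / 25 := by norm_num
  rw [e1, e2] at h
  exact h

/-- **@10 LEFT-EDGE FAMILY ON A THICK `U`-CELL from ONE bundle-WN node** (PINNED pair on `[U₁, U₂] × {−49/100}` solved at `22/25`, corner objective), window functions
discharged on the thick cell (`hflo`, `hcap`), three prices `−F ≤ bar″`, `−F − sl_j·(−1/50) ≤ bar″`. [cite: ScalapinoWhiteZhang1993, §II] [cite: BoydVandenberghe2004, §5.9] -/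
theorem covHg1201M19P10_leftEdgeStripCell_of_bundleWN {U₁ U₂ : ℝ} {flo cap : ℝ → ℝ → ℝ} {F sl₁ sl₂ : ℚ} (Uo : ℝ)
    (hrow : SquareTTPrimeBundleOrbitLowerRowWN U₁ U₂ (-49 / 100) (-49 / 100) flo cap F sl₁ sl₂ (22 / 25) Finset.univ (box 2 7) (-oddMomentObsTT (-49 / 100) Uo 0))
    (hflo : ∀ θ ∈ Set.Icc (![U₁, -49 / 100, 43 / 50] : Fin 3 → ℝ) ![U₂, -49 / 100, 22 / 25], flo (θ 0) (θ 1) ≤ energyDensityTT' 1 (θ 1) (θ 0) (θ 2))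
    (hcap : ∀ θ ∈ Set.Icc (![U₁, -49 / 100, 43 / 50] : Fin 3 → ℝ) ![U₂, -49 / 100, 22 / 25], energyDensityTT' 1 (θ 1) (θ 0) (θ 2) ≤ cap (θ 0) (θ 1))
    (p₀ : -F ≤ 4767609 / 10000000) (p₁ : -F - sl₁ * (43 / 50 - 22 / 25) ≤ 4767609 / 10000000)
    (p₂ : -F - sl₂ * (43 / 50 - 22 / 25) ≤ 4767609 / 10000000) :
    ∀ n ∈ Set.Icc (43 / 50 : ℝ) (22 / 25), ∀ σ ∈ Set.Icc (-49 / 100 : ℝ) (-47 / 100), ∀ U' ∈ Set.Icc U₁ U₂,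
      ∀ (ω : InfVolFermionState 2) (Ls : ℕ → ℕ) (ψ : ∀ L, Fock (Orb (FermionTorus 2 L))),
      Tendsto Ls atTop atTop →
      (∀ j, IsGroundStateInSector (hubbardTorusTT' (Ls j) 1 (-49 / 100) U') (rectN n (Ls j)) 0 (ψ (Ls j))) →
      (∀ j, star (ψ (Ls j)) ⬝ᵥ ψ (Ls j) = 1) → ω.IsTorusLimitOf ψ Ls →
      -(4767609 / 10000000 : ℝ) ≤ ((Finset.univ : Finset (DihedralGroup 4)).card : ℝ)⁻¹ * ∑ g ∈ (Finset.univ : Finset (DihedralGroup 4)),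
        (ω.expect (d4ShiftSet g 0 (box 2 7)) (fermionEmbed (PolySite.d4Emb g 0 (box 2 7)) (-oddMomentObsTT σ U' 0))).re := by
  have hr := p10l_neg_bundleWNStripSlot_le p₀ p₁ p₂
  have e : (((4767609 / 10000000 : ℚ)) : ℝ) = (4767609 / 10000000 : ℝ) := by norm_num
  rw [e] at hr
  exact covHg1201M19P10_leftEdgeSegment_of_boxRowW (by norm_num) le_rfl Uo (covHg1201M19P10_leftThickCell_boxRowW_of_bundleWN hrow)
    (fun θ hθ => hflo θ hθ) (fun θ hθ => hcap θ hθ) hr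

/-- **TOP-PLANE INSTANCE** (caps ON the `22/25` kernel HF row `−15830689/10⁷ + U·121/625`, floor kinematic; `3 ≤ U₁`): only the node and three rational prices remain.
[cite: ScalapinoWhiteZhang1993, §II] -/
theorem covHg1201M19P10_leftEdgeStripCell_of_bundleWN_topPlane {U₁ U₂ : ℝ} (hU₁ : 3 ≤ U₁) {F sl₁ sl₂ : ℚ} (Uo : ℝ)
    (hrow : SquareTTPrimeBundleOrbitLowerRowWN U₁ U₂ (-49 / 100) (-49 / 100) (fun (_ _ : ℝ) => (((-124827703/50000000 : ℚ)) : ℝ))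
      (fun (U _ : ℝ) => ((-15830689/10000000 : ℚ) : ℝ) + U * ((121/625 : ℚ) : ℝ)) F sl₁ sl₂ (22 / 25) Finset.univ (box 2 7)
      (-oddMomentObsTT (-49 / 100) Uo 0))
    (p₀ : -F ≤ 4767609 / 10000000) (p₁ : -F - sl₁ * (43 / 50 - 22 / 25) ≤ 4767609 / 10000000)
    (p₂ : -F - sl₂ * (43 / 50 - 22 / 25) ≤ 4767609 / 10000000) :
    ∀ n ∈ Set.Icc (43 / 50 : ℝ) (22 / 25), ∀ σ ∈ Set.Icc (-49 / 100 : ℝ) (-47 / 100), ∀ U' ∈ Set.Icc U₁ U₂,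
      ∀ (ω : InfVolFermionState 2) (Ls : ℕ → ℕ) (ψ : ∀ L, Fock (Orb (FermionTorus 2 L))),
      Tendsto Ls atTop atTop →
      (∀ j, IsGroundStateInSector (hubbardTorusTT' (Ls j) 1 (-49 / 100) U') (rectN n (Ls j)) 0 (ψ (Ls j))) →
      (∀ j, star (ψ (Ls j)) ⬝ᵥ ψ (Ls j) = 1) → ω.IsTorusLimitOf ψ Ls →
      -(4767609 / 10000000 : ℝ) ≤ ((Finset.univ : Finset (DihedralGroup 4)).card : ℝ)⁻¹ * ∑ g ∈ (Finset.univ : Finset (DihedralGroup 4)),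
        (ω.expect (d4ShiftSet g 0 (box 2 7)) (fermionEmbed (PolySite.d4Emb g 0 (box 2 7)) (-oddMomentObsTT σ U' 0))).re :=
  covHg1201M19P10_leftEdgeStripCell_of_bundleWN Uo hrow (covHg1201M19P10_leftThickCell_kinFloorFn (le_trans (by norm_num) hU₁))
    (covHg1201M19P10_leftThickCell_topPlaneCap hU₁) p₀ p₁ p₂

/-- **WND CONSUMER, AFFINE CAP** — the U-pair node shape of record (captain hubbard-cov-hg1201-plan-1 2026-08-28T15:57:16Z: «WND = bundle-WN + docc-ext», the node
file's own `cert_…_wnd_thickBoxRowW_of` adapter yields, after the docc discharge `hg1201P10_gsDocc_le_quarter_of_cap_le`, ONE thick windowed row on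
`![U₁, −49/100, 43/50] … ![U₂, −49/100, 22/25]` with the kinematic floor and an affine-in-`U` cap `ca + U·cb`): the family on the `U`-cell from that row, the two
top-plane end conditions (`3 ≤ U₁`) and the price `−r ≤ 0.4767609`. [cite: ScalapinoWhiteZhang1993, §II] [cite: BoydVandenberghe2004, §5.9] -/
theorem covHg1201M19P10_leftEdgeStripCell_of_thickBoxRowW_affineCap {U₁ U₂ : ℝ} (hU₁ : 3 ≤ U₁) {ca cb r : ℚ} (Uo : ℝ)
    (hrow : SquareTTPrimeCorrOrbitLowerBoxRowW ![U₁, -49 / 100, 43 / 50] ![U₂, -49 / 100, 22 / 25]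
      (fun _ => (((-124827703/50000000 : ℚ)) : ℝ)) (fun θ => ((ca : ℚ) : ℝ) + θ 0 * ((cb : ℚ) : ℝ)) r Finset.univ (box 2 7) (-oddMomentObsTT (-49 / 100) Uo 0))
    (he₁ : ((-15830689/10000000 : ℚ) : ℝ) + U₁ * ((121/625 : ℚ) : ℝ) ≤ ((ca : ℚ) : ℝ) + U₁ * ((cb : ℚ) : ℝ))
    (he₂ : ((-15830689/10000000 : ℚ) : ℝ) + U₂ * ((121/625 : ℚ) : ℝ) ≤ ((ca : ℚ) : ℝ) + U₂ * ((cb : ℚ) : ℝ))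
    (hr : -((r : ℚ) : ℝ) ≤ (4767609 / 10000000 : ℝ)) :
    ∀ n ∈ Set.Icc (43 / 50 : ℝ) (22 / 25), ∀ σ ∈ Set.Icc (-49 / 100 : ℝ) (-47 / 100), ∀ U' ∈ Set.Icc U₁ U₂,
      ∀ (ω : InfVolFermionState 2) (Ls : ℕ → ℕ) (ψ : ∀ L, Fock (Orb (FermionTorus 2 L))),
      Tendsto Ls atTop atTop →
      (∀ j, IsGroundStateInSector (hubbardTorusTT' (Ls j) 1 (-49 / 100) U') (rectN n (Ls j)) 0 (ψ (Ls j))) →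
      (∀ j, star (ψ (Ls j)) ⬝ᵥ ψ (Ls j) = 1) → ω.IsTorusLimitOf ψ Ls →
      -(4767609 / 10000000 : ℝ) ≤ ((Finset.univ : Finset (DihedralGroup 4)).card : ℝ)⁻¹ * ∑ g ∈ (Finset.univ : Finset (DihedralGroup 4)),
        (ω.expect (d4ShiftSet g 0 (box 2 7)) (fermionEmbed (PolySite.d4Emb g 0 (box 2 7)) (-oddMomentObsTT σ U' 0))).re :=
  covHg1201M19P10_leftEdgeSegment_of_boxRowW (by norm_num) le_rfl Uo hrow
    (covHg1201M19P10_leftThickCell_kinFloorFn (le_trans (by norm_num) hU₁)) (covHg1201M19P10_leftThickCell_affineCap_of_topPlane hU₁ he₁ he₂) hr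

/-- **WND CONSUMER, CONSTANT CAP** (a high-`U` pair booked with a constant `c` above the two polarised `−49/100` values `−6148940299/10¹⁰`, `−5511249107/10¹⁰`; `0 ≤ U₁`).
[cite: ScalapinoWhiteZhang1993, §II] [cite: BoydVandenberghe2004, §5.9] -/
theorem covHg1201M19P10_leftEdgeStripCell_of_thickBoxRowW_constCap {U₁ U₂ : ℝ} (hU₁ : 0 ≤ U₁) {c r : ℚ} (Uo : ℝ)
    (hc₁ : (-6148940299/10000000000 : ℚ) ≤ c) (hc₂ : (-5511249107/10000000000 : ℚ) ≤ c)
    (hrow : SquareTTPrimeCorrOrbitLowerBoxRowW ![U₁, -49 / 100, 43 / 50] ![U₂, -49 / 100, 22 / 25]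
      (fun _ => (((-124827703/50000000 : ℚ)) : ℝ)) (fun _ => ((c : ℚ) : ℝ)) r Finset.univ (box 2 7) (-oddMomentObsTT (-49 / 100) Uo 0))
    (hr : -((r : ℚ) : ℝ) ≤ (4767609 / 10000000 : ℝ)) :
    ∀ n ∈ Set.Icc (43 / 50 : ℝ) (22 / 25), ∀ σ ∈ Set.Icc (-49 / 100 : ℝ) (-47 / 100), ∀ U' ∈ Set.Icc U₁ U₂,
      ∀ (ω : InfVolFermionState 2) (Ls : ℕ → ℕ) (ψ : ∀ L, Fock (Orb (FermionTorus 2 L))),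
      Tendsto Ls atTop atTop →
      (∀ j, IsGroundStateInSector (hubbardTorusTT' (Ls j) 1 (-49 / 100) U') (rectN n (Ls j)) 0 (ψ (Ls j))) →
      (∀ j, star (ψ (Ls j)) ⬝ᵥ ψ (Ls j) = 1) → ω.IsTorusLimitOf ψ Ls →
      -(4767609 / 10000000 : ℝ) ≤ ((Finset.univ : Finset (DihedralGroup 4)).card : ℝ)⁻¹ * ∑ g ∈ (Finset.univ : Finset (DihedralGroup 4)),
        (ω.expect (d4ShiftSet g 0 (box 2 7)) (fermionEmbed (PolySite.d4Emb g 0 (box 2 7)) (-oddMomentObsTT σ U' 0))).re :=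
  covHg1201M19P10_leftEdgeSegment_of_boxRowW (by norm_num) le_rfl Uo hrow
    (covHg1201M19P10_leftThickCell_kinFloorFn hU₁) (covHg1201M19P10_leftThickCell_constCap_of_polCaps hU₁ hc₁ hc₂) hr

/-! ## §4 Glue and the item -/

/-- **UNION of two adjacent `U`-cells** (@10 family on the strip, full slot range `[−49/100, −47/100]`). [folklore] -/
theorem covHg1201M19P10_leftEdgeStrip_union {a b c : ℝ}
    (h₁ : ∀ n ∈ Set.Icc (43 / 50 : ℝ) (22 / 25), ∀ σ ∈ Set.Icc (-49 / 100 : ℝ) (-47 / 100), ∀ U' ∈ Set.Icc a b,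
      ∀ (ω : InfVolFermionState 2) (Ls : ℕ → ℕ) (ψ : ∀ L, Fock (Orb (FermionTorus 2 L))),
      Tendsto Ls atTop atTop →
      (∀ j, IsGroundStateInSector (hubbardTorusTT' (Ls j) 1 (-49 / 100) U') (rectN n (Ls j)) 0 (ψ (Ls j))) →
      (∀ j, star (ψ (Ls j)) ⬝ᵥ ψ (Ls j) = 1) → ω.IsTorusLimitOf ψ Ls →
      -(4767609 / 10000000 : ℝ) ≤ ((Finset.univ : Finset (DihedralGroup 4)).card : ℝ)⁻¹ * ∑ g ∈ (Finset.univ : Finset (DihedralGroup 4)),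
        (ω.expect (d4ShiftSet g 0 (box 2 7)) (fermionEmbed (PolySite.d4Emb g 0 (box 2 7)) (-oddMomentObsTT σ U' 0))).re)
    (h₂ : ∀ n ∈ Set.Icc (43 / 50 : ℝ) (22 / 25), ∀ σ ∈ Set.Icc (-49 / 100 : ℝ) (-47 / 100), ∀ U' ∈ Set.Icc b c,
      ∀ (ω : InfVolFermionState 2) (Ls : ℕ → ℕ) (ψ : ∀ L, Fock (Orb (FermionTorus 2 L))),
      Tendsto Ls atTop atTop →
      (∀ j, IsGroundStateInSector (hubbardTorusTT' (Ls j) 1 (-49 / 100) U') (rectN n (Ls j)) 0 (ψ (Ls j))) →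
      (∀ j, star (ψ (Ls j)) ⬝ᵥ ψ (Ls j) = 1) → ω.IsTorusLimitOf ψ Ls →
      -(4767609 / 10000000 : ℝ) ≤ ((Finset.univ : Finset (DihedralGroup 4)).card : ℝ)⁻¹ * ∑ g ∈ (Finset.univ : Finset (DihedralGroup 4)),
        (ω.expect (d4ShiftSet g 0 (box 2 7)) (fermionEmbed (PolySite.d4Emb g 0 (box 2 7)) (-oddMomentObsTT σ U' 0))).re) :
    ∀ n ∈ Set.Icc (43 / 50 : ℝ) (22 / 25), ∀ σ ∈ Set.Icc (-49 / 100 : ℝ) (-47 / 100), ∀ U' ∈ Set.Icc a c,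
      ∀ (ω : InfVolFermionState 2) (Ls : ℕ → ℕ) (ψ : ∀ L, Fock (Orb (FermionTorus 2 L))),
      Tendsto Ls atTop atTop →
      (∀ j, IsGroundStateInSector (hubbardTorusTT' (Ls j) 1 (-49 / 100) U') (rectN n (Ls j)) 0 (ψ (Ls j))) →
      (∀ j, star (ψ (Ls j)) ⬝ᵥ ψ (Ls j) = 1) → ω.IsTorusLimitOf ψ Ls →
      -(4767609 / 10000000 : ℝ) ≤ ((Finset.univ : Finset (DihedralGroup 4)).card : ℝ)⁻¹ * ∑ g ∈ (Finset.univ : Finset (DihedralGroup 4)),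
        (ω.expect (d4ShiftSet g 0 (box 2 7)) (fermionEmbed (PolySite.d4Emb g 0 (box 2 7)) (-oddMomentObsTT σ U' 0))).re := by
  intro n hn σ hσ U' hU' ω Ls ψ hLs hψ h1 hω
  rcases le_or_gt U' b with hle | hgt
  · exact h₁ n hn σ hσ U' ⟨hU'.1, hle⟩ ω Ls ψ hLs hψ h1 hω
  · exact h₂ n hn σ hσ U' ⟨hgt.le, hU'.2⟩ ω Ls ψ hLs hψ h1 hω

/-- **A CHAIN of consecutive cells** `l 0, …, l k` (`k ≠ 0`). [folklore] -/
theorem covHg1201M19P10_leftEdgeStrip_of_chain (l : ℕ → ℝ) (k : ℕ) (hk0 : k ≠ 0)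
    (fam : ∀ i < k, ∀ n ∈ Set.Icc (43 / 50 : ℝ) (22 / 25), ∀ σ ∈ Set.Icc (-49 / 100 : ℝ) (-47 / 100), ∀ U' ∈ Set.Icc (l i) (l (i + 1)),
      ∀ (ω : InfVolFermionState 2) (Ls : ℕ → ℕ) (ψ : ∀ L, Fock (Orb (FermionTorus 2 L))),
      Tendsto Ls atTop atTop →
      (∀ j, IsGroundStateInSector (hubbardTorusTT' (Ls j) 1 (-49 / 100) U') (rectN n (Ls j)) 0 (ψ (Ls j))) →
      (∀ j, star (ψ (Ls j)) ⬝ᵥ ψ (Ls j) = 1) → ω.IsTorusLimitOf ψ Ls →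
      -(4767609 / 10000000 : ℝ) ≤ ((Finset.univ : Finset (DihedralGroup 4)).card : ℝ)⁻¹ * ∑ g ∈ (Finset.univ : Finset (DihedralGroup 4)),
        (ω.expect (d4ShiftSet g 0 (box 2 7)) (fermionEmbed (PolySite.d4Emb g 0 (box 2 7)) (-oddMomentObsTT σ U' 0))).re) :
    ∀ n ∈ Set.Icc (43 / 50 : ℝ) (22 / 25), ∀ σ ∈ Set.Icc (-49 / 100 : ℝ) (-47 / 100), ∀ U' ∈ Set.Icc (l 0) (l k),
      ∀ (ω : InfVolFermionState 2) (Ls : ℕ → ℕ) (ψ : ∀ L, Fock (Orb (FermionTorus 2 L))),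
      Tendsto Ls atTop atTop →
      (∀ j, IsGroundStateInSector (hubbardTorusTT' (Ls j) 1 (-49 / 100) U') (rectN n (Ls j)) 0 (ψ (Ls j))) →
      (∀ j, star (ψ (Ls j)) ⬝ᵥ ψ (Ls j) = 1) → ω.IsTorusLimitOf ψ Ls →
      -(4767609 / 10000000 : ℝ) ≤ ((Finset.univ : Finset (DihedralGroup 4)).card : ℝ)⁻¹ * ∑ g ∈ (Finset.univ : Finset (DihedralGroup 4)),
        (ω.expect (d4ShiftSet g 0 (box 2 7)) (fermionEmbed (PolySite.d4Emb g 0 (box 2 7)) (-oddMomentObsTT σ U' 0))).re := by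
  have main : ∀ j ≤ k, j ≠ 0 → ∀ n ∈ Set.Icc (43 / 50 : ℝ) (22 / 25), ∀ σ ∈ Set.Icc (-49 / 100 : ℝ) (-47 / 100), ∀ U' ∈ Set.Icc (l 0) (l j),
      ∀ (ω : InfVolFermionState 2) (Ls : ℕ → ℕ) (ψ : ∀ L, Fock (Orb (FermionTorus 2 L))),
      Tendsto Ls atTop atTop →
      (∀ j, IsGroundStateInSector (hubbardTorusTT' (Ls j) 1 (-49 / 100) U') (rectN n (Ls j)) 0 (ψ (Ls j))) →
      (∀ j, star (ψ (Ls j)) ⬝ᵥ ψ (Ls j) = 1) → ω.IsTorusLimitOf ψ Ls →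
      -(4767609 / 10000000 : ℝ) ≤ ((Finset.univ : Finset (DihedralGroup 4)).card : ℝ)⁻¹ * ∑ g ∈ (Finset.univ : Finset (DihedralGroup 4)),
        (ω.expect (d4ShiftSet g 0 (box 2 7)) (fermionEmbed (PolySite.d4Emb g 0 (box 2 7)) (-oddMomentObsTT σ U' 0))).re := by
    intro j
    induction j with
    | zero => intro _ h; exact absurd rfl h
    | succ m ih =>
      intro hm _
      rcases Nat.eq_zero_or_pos m with hz | hpos
      · subst hz; exact fam 0 (by omega)
      · exact covHg1201M19P10_leftEdgeStrip_union (ih (by omega) (by omega)) (fam m (by omega))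
  exact main k le_rfl hk0

/-- **«PatchLeftEdgeP10» (stmt-Ventures-27104) from the family on the FULL edge `[3, 17/2]`** (densities `n ≤ 43/50` are state-free:
`covHg1201M19P10_PatchLeftEdgeP10_of_highDensityStrip`, hubbard-cov-hg1201-box-2 g0). [cite: ScalapinoWhiteZhang1993, §II] -/
theorem covHg1201M19P10_PatchLeftEdgeP10_of_leftEdgeStrip
    (h : ∀ n ∈ Set.Icc (43 / 50 : ℝ) (22 / 25), ∀ σ ∈ Set.Icc (-49 / 100 : ℝ) (-47 / 100), ∀ U' ∈ Set.Icc (3 : ℝ) (17 / 2),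
      ∀ (ω : InfVolFermionState 2) (Ls : ℕ → ℕ) (ψ : ∀ L, Fock (Orb (FermionTorus 2 L))),
      Tendsto Ls atTop atTop →
      (∀ j, IsGroundStateInSector (hubbardTorusTT' (Ls j) 1 (-49 / 100) U') (rectN n (Ls j)) 0 (ψ (Ls j))) →
      (∀ j, star (ψ (Ls j)) ⬝ᵥ ψ (Ls j) = 1) → ω.IsTorusLimitOf ψ Ls →
      -(4767609 / 10000000 : ℝ) ≤ ((Finset.univ : Finset (DihedralGroup 4)).card : ℝ)⁻¹ * ∑ g ∈ (Finset.univ : Finset (DihedralGroup 4)),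
        (ω.expect (d4ShiftSet g 0 (box 2 7)) (fermionEmbed (PolySite.d4Emb g 0 (box 2 7)) (-oddMomentObsTT σ U' 0))).re) :
    PatchLeftEdgeP10 :=
  covHg1201M19P10_PatchLeftEdgeP10_of_highDensityStrip h

/-- **«PatchLeftEdgeP10» from TWO cells** (breakpoint `b`, e.g. the hub/spoke abscissa of the first pinned pair). [cite: ScalapinoWhiteZhang1993, §II] -/
theorem covHg1201M19P10_PatchLeftEdgeP10_of_twoCells {b : ℝ}
    (h₁ : ∀ n ∈ Set.Icc (43 / 50 : ℝ) (22 / 25), ∀ σ ∈ Set.Icc (-49 / 100 : ℝ) (-47 / 100), ∀ U' ∈ Set.Icc (3 : ℝ) b,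
      ∀ (ω : InfVolFermionState 2) (Ls : ℕ → ℕ) (ψ : ∀ L, Fock (Orb (FermionTorus 2 L))),
      Tendsto Ls atTop atTop →
      (∀ j, IsGroundStateInSector (hubbardTorusTT' (Ls j) 1 (-49 / 100) U') (rectN n (Ls j)) 0 (ψ (Ls j))) →
      (∀ j, star (ψ (Ls j)) ⬝ᵥ ψ (Ls j) = 1) → ω.IsTorusLimitOf ψ Ls →
      -(4767609 / 10000000 : ℝ) ≤ ((Finset.univ : Finset (DihedralGroup 4)).card : ℝ)⁻¹ * ∑ g ∈ (Finset.univ : Finset (DihedralGroup 4)),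
        (ω.expect (d4ShiftSet g 0 (box 2 7)) (fermionEmbed (PolySite.d4Emb g 0 (box 2 7)) (-oddMomentObsTT σ U' 0))).re)
    (h₂ : ∀ n ∈ Set.Icc (43 / 50 : ℝ) (22 / 25), ∀ σ ∈ Set.Icc (-49 / 100 : ℝ) (-47 / 100), ∀ U' ∈ Set.Icc b (17 / 2),
      ∀ (ω : InfVolFermionState 2) (Ls : ℕ → ℕ) (ψ : ∀ L, Fock (Orb (FermionTorus 2 L))),
      Tendsto Ls atTop atTop →
      (∀ j, IsGroundStateInSector (hubbardTorusTT' (Ls j) 1 (-49 / 100) U') (rectN n (Ls j)) 0 (ψ (Ls j))) →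
      (∀ j, star (ψ (Ls j)) ⬝ᵥ ψ (Ls j) = 1) → ω.IsTorusLimitOf ψ Ls →
      -(4767609 / 10000000 : ℝ) ≤ ((Finset.univ : Finset (DihedralGroup 4)).card : ℝ)⁻¹ * ∑ g ∈ (Finset.univ : Finset (DihedralGroup 4)),
        (ω.expect (d4ShiftSet g 0 (box 2 7)) (fermionEmbed (PolySite.d4Emb g 0 (box 2 7)) (-oddMomentObsTT σ U' 0))).re) :
    PatchLeftEdgeP10 :=
  covHg1201M19P10_PatchLeftEdgeP10_of_leftEdgeStrip (covHg1201M19P10_leftEdgeStrip_union h₁ h₂)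

/-- **«PatchLeftEdgeP10» from a CHAIN of cells** `3 = l 0, …, l k = 17/2`. [cite: ScalapinoWhiteZhang1993, §II] -/
theorem covHg1201M19P10_PatchLeftEdgeP10_of_chain (l : ℕ → ℝ) (k : ℕ) (hk0 : k ≠ 0) (h0 : l 0 = 3) (hk : l k = 17 / 2)
    (fam : ∀ i < k, ∀ n ∈ Set.Icc (43 / 50 : ℝ) (22 / 25), ∀ σ ∈ Set.Icc (-49 / 100 : ℝ) (-47 / 100), ∀ U' ∈ Set.Icc (l i) (l (i + 1)),
      ∀ (ω : InfVolFermionState 2) (Ls : ℕ → ℕ) (ψ : ∀ L, Fock (Orb (FermionTorus 2 L))),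
      Tendsto Ls atTop atTop →
      (∀ j, IsGroundStateInSector (hubbardTorusTT' (Ls j) 1 (-49 / 100) U') (rectN n (Ls j)) 0 (ψ (Ls j))) →
      (∀ j, star (ψ (Ls j)) ⬝ᵥ ψ (Ls j) = 1) → ω.IsTorusLimitOf ψ Ls →
      -(4767609 / 10000000 : ℝ) ≤ ((Finset.univ : Finset (DihedralGroup 4)).card : ℝ)⁻¹ * ∑ g ∈ (Finset.univ : Finset (DihedralGroup 4)),
        (ω.expect (d4ShiftSet g 0 (box 2 7)) (fermionEmbed (PolySite.d4Emb g 0 (box 2 7)) (-oddMomentObsTT σ U' 0))).re) :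
    PatchLeftEdgeP10 := by
  have h := covHg1201M19P10_leftEdgeStrip_of_chain l k hk0 fam
  rw [h0, hk] at h
  exact covHg1201M19P10_PatchLeftEdgeP10_of_leftEdgeStrip h

end Summit.Ventures.CertifiedManyBodySolver.Theorems

end
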